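import Summits.QuantumFields.YangMills.Theorems.QuantileBitPuritySectorDefs
import Summits.QuantumFields.YangMills.Theorems.LuscherReductionRunningReductionTraceFormulaKernel
import Summits.QuantumFields.YangMills.Theorems.LuscherReductionTwistedTraceScalingAllLinks
import Summits.QuantumFields.YangMills.Theorems.LuscherReductionTwistedTraceScalingGaugeSliceKernel
import HarnessLib

/-!
# The gauge-averaged bond kernel `K_β^G` and the total weight of a seam sector as a TWISTED diagonal kernel iterate

Support module (`--supports` stmt-QuantumFields-23948, `QuantileBitPurity.HolonomyQuantileSubQuartic`; LINE g12-B of seat ym-idea-4, memo HOME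
`bc/g14-dw/SECTORS-translates.md` §0).  First half of the proof that a twisted seam sector never outweighs the periodic one (companion module
`QuantileBitPuritySectorTwistBound`).  With `K_β^G(U,V) = ∫ K_β(U, g·V) dg` (`TT.gaugeKernel`) and the sector weights `TT.sectorWeight`
(defs module `QuantileBitPuritySectorDefs`) we prove, WITHOUT spectral input:

* §1 `K_β^G` (`= TwoLattice.Avg.avgKernel`, `gaugeKernel_eq_avgKernel`): bound, non-negativity, joint measurability, SYMMETRY, invariance under gauge transformations of either slot and under a simultaneous
  composite centre twist; `∫ K_β^G(U,V) ψ(V) dV = ∫ K_β(U,V) ψ(V) dV` for bounded measurable gauge-invariant `ψ` (and the tree's `TwoLattice.Avg.transferApply_gaugeTransform_of_invariant`), hence ★ `iterate_gaugeKernelOp_eq`: the `K_β`- and `K_β^G`-iterates agree on gauge-invariant seeds (and stay bounded,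
  measurable, gauge invariant);
* §2 ★ `sectorWeight_one_eq_integral_iterate_twisted`: `sectorWeight β (m+1) z 1 = ∫ (κ_{K^G}^{[m+1]} K^G(·, x))(tw_z x) dx` — the seam field
  integrated out (`sectorWeight_one_eq_integral_gaugeKernel`), the cycle peeled (Lit `integral_cyclic_het_eq_foldr`), the interior bonds
  homogenised to `K_β^G` (§1), and the substitution `x ↦ tw_z x` (an involution preserving the a-priori measure; joint measurability of the iterated
  sections `measurable_iterate_gaugeKernel_section`).  This is exactly the twisted diagonal iterate of Lit `TwistedKernelTraceFormula`.

HONEST FRAMING: fixed-lattice transfer-matrix bookkeeping; no semiclassics/RG; nothing about infinite volume, the continuum limit or the Clay gap.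
No `sorry`, no new axiom, no new definition.  References: [cite: tHooft1979]; [cite: SeilerLNP1982, §3]; [cite: Luscher1983, §2]; [cite: MontvayMunster1994, (3.145)].
-/

set_option autoImplicit false

noncomputable section

open MeasureTheory Filter Topology Real Function
open scoped BigOperators InnerProductSpace
open Literature.MathematicalPhysics.QuantumLattice
open Literature.MathematicalPhysics.QuantumFieldTheory hiding SU2
open Literature.Analysis.OperatorTheory
open Summit.QuantumFields.YangMills.Theorems

namespace Summit.QuantumFields.YangMills.Theorems.FemtoTransferGap.TT

open Summit.QuantumFields.YangMills.Theorems.FemtoTransferGap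
open Summit.QuantumFields.YangMills.Theorems.FemtoTransferGap.TwoLattice.TowerA

variable {L : ℕ} [NeZero L]

/-! ## §1 The gauge-averaged bond kernel -/

/-- `TT.gaugeKernel` IS the tree's gauge-averaged kernel `TwoLattice.Avg.avgKernel` of the «twolattice» line (same integral; the two a-priori
`gaugeMeasure`s are the same product Haar measure) — so that line's API (`avgKernel_pos`, `avgKernel_symm`, `qform_eq_integral_avgKernel`, …)
applies verbatim. [cite: SeilerLNP1982, §3] -/
theorem gaugeKernel_eq_avgKernel (β : ℝ) (U V : GaugeConfig 3 L SU2) : gaugeKernel β U V = TwoLattice.Avg.avgKernel β U V := rfl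

/-- **Bound** `|K_β^G(U,V)| ≤ M`. [folklore] -/
theorem abs_gaugeKernel_le {β M : ℝ} (hM : ∀ U V : GaugeConfig 3 L SU2, |transferKernel su2Rep β U V| ≤ M) (U V : GaugeConfig 3 L SU2) :
    |gaugeKernel β U V| ≤ M := by
  haveI := isProbabilityMeasure_gaugeMeasure (L := L)
  rw [gaugeKernel_apply]
  have h := norm_integral_le_of_norm_le_const (μ := gaugeMeasure L) (f := fun g : Site 3 L → SU2 => transferKernel su2Rep β U (gaugeTransform g V))
    (C := M) (ae_of_all _ fun g => by rw [Real.norm_eq_abs]; exact hM _ _)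
  rwa [probReal_univ, mul_one, Real.norm_eq_abs] at h

/-- `K_β^G` is non-negative. [folklore] -/
theorem gaugeKernel_nonneg (β : ℝ) (U V : GaugeConfig 3 L SU2) : 0 ≤ gaugeKernel β U V := by
  rw [gaugeKernel_apply]
  exact integral_nonneg fun g => (transferKernel_pos _ _ _ _).le

/-- **Joint measurability** of `K_β^G`. [folklore] -/
theorem stronglyMeasurable_gaugeKernel (β : ℝ) :
    StronglyMeasurable (uncurry fun U V : GaugeConfig 3 L SU2 => gaugeKernel β U V) := by
  haveI := isProbabilityMeasure_gaugeMeasure (L := L)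
  have hK := (PhysL2.stronglyMeasurable_transferKernel (L := L) β).measurable
  have hA : Measurable fun q : (GaugeConfig 3 L SU2 × GaugeConfig 3 L SU2) × (Site 3 L → SU2) => (q.2, q.1.2) :=
    measurable_snd.prodMk (measurable_snd.comp measurable_fst)
  have hB := (measurable_act_uncurry (L := L) (fun _ => false)).comp hA
  have hC := (measurable_fst.comp (measurable_fst (α := GaugeConfig 3 L SU2 × GaugeConfig 3 L SU2)
    (β := Site 3 L → SU2))).prodMk hB
  have h2 := hK.comp hC
  have h3 : StronglyMeasurable (uncurry fun (p : GaugeConfig 3 L SU2 × GaugeConfig 3 L SU2) (g : Site 3 L → SU2) =>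
      transferKernel su2Rep β p.1 (gaugeTransform g (twist3 (fun _ => false) p.2))) := h2.stronglyMeasurable
  have h4 := StronglyMeasurable.integral_prod_right (ν := gaugeMeasure L) h3
  have h5 : (uncurry fun U V : GaugeConfig 3 L SU2 => gaugeKernel β U V) =
      fun p : GaugeConfig 3 L SU2 × GaugeConfig 3 L SU2 => ∫ g, transferKernel su2Rep β p.1 (gaugeTransform g (twist3 (fun _ => false) p.2))
        ∂gaugeMeasure L := by
    funext p; simp only [uncurry, gaugeKernel_apply, twist3_false]
  rw [h5]
  exact h4

/-- The right section `V ↦ K_β^G(U,V)` is measurable. [folklore] -/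
theorem measurable_gaugeKernel_right (β : ℝ) (U : GaugeConfig 3 L SU2) : Measurable fun V : GaugeConfig 3 L SU2 => gaugeKernel β U V := by
  haveI := isProbabilityMeasure_gaugeMeasure (L := L)
  have h1 := StronglyMeasurable.integral_prod_right (ν := gaugeMeasure L)
    (stronglyMeasurable_act_swap (measurable_transferKernel_right β U) (fun _ => false))
  have h2 : (fun V : GaugeConfig 3 L SU2 => gaugeKernel β U V) =
      fun V => ∫ g, transferKernel su2Rep β U (gaugeTransform g (twist3 (fun _ => false) V)) ∂gaugeMeasure L := by
    funext V; simp only [gaugeKernel_apply, twist3_false]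
  rw [h2]
  exact h1.measurable

/-- **Invariance under a gauge transformation of the right slot** (right invariance of Haar measure). [cite: SeilerLNP1982, §3] -/
theorem gaugeKernel_gaugeTransform_right (β : ℝ) (g₀ : Site 3 L → SU2) (U V : GaugeConfig 3 L SU2) :
    gaugeKernel β U (gaugeTransform g₀ V) = gaugeKernel β U V := by
  haveI := isMulRightInvariant_gaugeMeasure (L := L)
  rw [gaugeKernel_apply, gaugeKernel_apply]
  simp_rw [gaugeTransform_gaugeTransform]
  exact integral_mul_right_eq_self (fun g : Site 3 L → SU2 => transferKernel su2Rep β U (gaugeTransform g V)) g₀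

/-- **Symmetry** `K_β^G(U,V) = K_β^G(V,U)` (gauge invariance and symmetry of `K_β`, inversion invariance of Haar measure). [cite: SeilerLNP1982, §3] -/
theorem gaugeKernel_symm (β : ℝ) (U V : GaugeConfig 3 L SU2) : gaugeKernel β U V = gaugeKernel β V U := by
  haveI := isInvInvariant_gaugeMeasure (L := L)
  rw [gaugeKernel_apply, gaugeKernel_apply]
  have h1 : ∀ g : Site 3 L → SU2, transferKernel su2Rep β U (gaugeTransform g V) = transferKernel su2Rep β V (gaugeTransform g⁻¹ U) := fun g => by
    rw [← transferKernel_gaugeTransform su2Rep β g⁻¹ U (gaugeTransform g V), gaugeTransform_inv_gaugeTransform, transferKernel_su2Rep_symm]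
  simp_rw [h1]
  exact (integral_inv_eq_self (fun g : Site 3 L → SU2 => transferKernel su2Rep β V (gaugeTransform g U)) (gaugeMeasure L))

/-- **Invariance under a gauge transformation of the left slot.** [cite: SeilerLNP1982, §3] -/
theorem gaugeKernel_gaugeTransform_left (β : ℝ) (g₀ : Site 3 L → SU2) (U V : GaugeConfig 3 L SU2) :
    gaugeKernel β (gaugeTransform g₀ U) V = gaugeKernel β U V := by
  rw [gaugeKernel_symm, gaugeKernel_gaugeTransform_right, gaugeKernel_symm]

/-- **Invariance under a simultaneous composite centre twist.** [cite: tHooft1979] -/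
theorem gaugeKernel_twist3 (β : ℝ) (z : Fin 3 → Bool) (U V : GaugeConfig 3 L SU2) :
    gaugeKernel β (twist3 z U) (twist3 z V) = gaugeKernel β U V := by
  rw [gaugeKernel_apply, gaugeKernel_apply]
  refine integral_congr_ae (ae_of_all _ fun g => ?_)
  dsimp only
  rw [gaugeTransform_twist3, transferKernel_twist3]

/-- **`K_β^G` acts as `K_β` on gauge-invariant test functions**: `∫ K_β^G(U,V) ψ(V) dV = ∫ K_β(U,V) ψ(V) dV` (Fubini, invariance of the
a-priori measure under `V ↦ g·V`, invariance of `ψ`). [cite: Luscher1983, §2] -/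
theorem integral_gaugeKernel_mul_of_gaugeInv (β : ℝ) {ψ : GaugeConfig 3 L SU2 → ℝ} (hψm : Measurable ψ) {C : ℝ} (hψb : ∀ U, |ψ U| ≤ C)
    (hψg : ∀ (g : Site 3 L → SU2) (U : GaugeConfig 3 L SU2), ψ (gaugeTransform g U) = ψ U) (U : GaugeConfig 3 L SU2) :
    ∫ V, gaugeKernel β U V * ψ V ∂configMeasure SU2 L = ∫ V, transferKernel su2Rep β U V * ψ V ∂configMeasure SU2 L := by
  haveI := isProbabilityMeasure_gaugeMeasure (L := L)
  obtain ⟨M, -, hM⟩ := exists_abs_transferKernel_le (L := L) β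
  have hC0 : 0 ≤ C := (abs_nonneg _).trans (hψb fun _ => 1)
  have hF : StronglyMeasurable (uncurry fun (V : GaugeConfig 3 L SU2) (g : Site 3 L → SU2) =>
      transferKernel su2Rep β U (gaugeTransform g (twist3 (fun _ => false) V)) * ψ V) :=
    (stronglyMeasurable_act_swap (measurable_transferKernel_right β U) (fun _ => false)).mul ((hψm.comp measurable_fst).stronglyMeasurable)
  have hint : Integrable (uncurry fun (V : GaugeConfig 3 L SU2) (g : Site 3 L → SU2) =>
      transferKernel su2Rep β U (gaugeTransform g (twist3 (fun _ => false) V)) * ψ V) ((configMeasure SU2 L).prod (gaugeMeasure L)) := by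
    refine Integrable.of_bound hF.aestronglyMeasurable (M * C) (ae_of_all _ fun p => ?_)
    rw [uncurry_apply_pair, norm_mul, Real.norm_eq_abs, Real.norm_eq_abs]
    exact mul_le_mul (hM _ _) (hψb _) (abs_nonneg _) ((abs_nonneg _).trans (hM U U))
  calc ∫ V, gaugeKernel β U V * ψ V ∂configMeasure SU2 L
      = ∫ V, ∫ g, transferKernel su2Rep β U (gaugeTransform g (twist3 (fun _ => false) V)) * ψ V ∂gaugeMeasure L ∂configMeasure SU2 L := by
        refine integral_congr_ae (ae_of_all _ fun V => ?_)
        dsimp only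
        rw [gaugeKernel_apply, ← integral_mul_const]
        simp only [twist3_false]
    _ = ∫ g, ∫ V, transferKernel su2Rep β U (gaugeTransform g (twist3 (fun _ => false) V)) * ψ V ∂configMeasure SU2 L ∂gaugeMeasure L :=
        integral_integral_swap hint
    _ = ∫ g, ∫ V, transferKernel su2Rep β U V * ψ V ∂configMeasure SU2 L ∂gaugeMeasure L := by
        refine integral_congr_ae (ae_of_all _ fun g => ?_)
        have hm : Measurable fun W : GaugeConfig 3 L SU2 => transferKernel su2Rep β U W * ψ W := (measurable_transferKernel_right β U).mul hψm
        rw [← integral_comp_eq_of_measurePreserving (measurePreserving_act g fun _ => false) hm]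
        refine integral_congr_ae (ae_of_all _ fun V => ?_)
        dsimp only
        rw [twist3_false, hψg]
    _ = ∫ V, transferKernel su2Rep β U V * ψ V ∂configMeasure SU2 L := by
        rw [integral_const, probReal_univ, one_smul]

/-- **Iterates**: on a bounded measurable gauge-invariant seed the iterated pointwise operators of `K_β^G` and of `K_β` coincide, and the
iterate stays bounded, measurable and gauge invariant. [cite: Luscher1983, §2] -/
theorem iterate_gaugeKernelOp_eq (β : ℝ) {ψ : GaugeConfig 3 L SU2 → ℝ} (hψm : Measurable ψ) {C : ℝ} (hψb : ∀ U, |ψ U| ≤ C)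
    (hψg : ∀ (g : Site 3 L → SU2) (U : GaugeConfig 3 L SU2), ψ (gaugeTransform g U) = ψ U) (m : ℕ) :
    (fun f : GaugeConfig 3 L SU2 → ℝ => fun U => ∫ V, gaugeKernel β U V * f V ∂configMeasure SU2 L)^[m] ψ =
      (fun f : GaugeConfig 3 L SU2 → ℝ => fun U => ∫ V, transferKernel su2Rep β U V * f V ∂configMeasure SU2 L)^[m] ψ ∧
    Measurable ((fun f : GaugeConfig 3 L SU2 → ℝ => fun U => ∫ V, transferKernel su2Rep β U V * f V ∂configMeasure SU2 L)^[m] ψ) ∧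
    (∃ C' : ℝ, ∀ U, |(fun f : GaugeConfig 3 L SU2 → ℝ => fun U => ∫ V, transferKernel su2Rep β U V * f V ∂configMeasure SU2 L)^[m] ψ U| ≤ C') ∧
    (∀ (g : Site 3 L → SU2) (U : GaugeConfig 3 L SU2),
      (fun f : GaugeConfig 3 L SU2 → ℝ => fun U => ∫ V, transferKernel su2Rep β U V * f V ∂configMeasure SU2 L)^[m] ψ (gaugeTransform g U) =
        (fun f : GaugeConfig 3 L SU2 → ℝ => fun U => ∫ V, transferKernel su2Rep β U V * f V ∂configMeasure SU2 L)^[m] ψ U) := by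
  obtain ⟨M, hM⟩ := exists_transferKernel_le su2Rep continuous_su2Rep β (L := L)
  induction m with
  | zero => exact ⟨rfl, hψm, ⟨C, hψb⟩, hψg⟩
  | succ m ih =>
    obtain ⟨ih1, ih2, ⟨C', ih3⟩, ih4⟩ := ih
    have hK : (fun f : GaugeConfig 3 L SU2 → ℝ => fun U => ∫ V, transferKernel su2Rep β U V * f V ∂configMeasure SU2 L)^[m + 1] ψ =
        transferApply β ((fun f : GaugeConfig 3 L SU2 → ℝ => fun U => ∫ V, transferKernel su2Rep β U V * f V ∂configMeasure SU2 L)^[m] ψ) := by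
      rw [Function.iterate_succ_apply']
      funext U
      rw [transferApply_apply]
    refine ⟨?_, ?_, ?_, ?_⟩
    · rw [Function.iterate_succ_apply', ih1, hK]
      funext U
      rw [integral_gaugeKernel_mul_of_gaugeInv β ih2 ih3 ih4 U, transferApply_apply]
    · rw [hK]; exact measurable_transferApply β ih2
    · rw [hK]; exact ⟨M * C', abs_transferApply_le β hM ih2 ih3⟩
    · rw [hK]; exact TwoLattice.Avg.transferApply_gaugeTransform_of_invariant β ih2 ih4

/-! ## §2 The total weight of a sector as a twisted diagonal iterate of `K_β^G` -/

/-- **The seam field integrated out**: `sectorWeight β n z 1 = ∫ dU⃗ ∏_{i<n} K_β(U_i,U_{i+1}) · K_β^G(U_n, tw_z U_0)`. [cite: MontvayMunster1994, (3.145)] -/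
theorem sectorWeight_one_eq_integral_gaugeKernel (β : ℝ) (n : ℕ) (z : Fin 3 → Bool) :
    sectorWeight (L := L) β n z (fun _ _ => (1 : ℝ)) = ∫ Us : Fin (n + 1) → GaugeConfig 3 L SU2,
      (∏ i : Fin n, transferKernel su2Rep β (Us i.castSucc) (Us i.succ)) * gaugeKernel β (Us (Fin.last n)) (twist3 z (Us 0))
      ∂(Measure.pi fun _ : Fin (n + 1) => configMeasure SU2 L) := by
  haveI := isProbabilityMeasure_gaugeMeasure (L := L)
  obtain ⟨M, hM0, hM⟩ := PhysL2.exists_norm_transferKernel_le (L := L) β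
  have hint : Integrable (uncurry fun (Us : Fin (n + 1) → GaugeConfig 3 L SU2) (g : Site 3 L → SU2) =>
      (∏ i : Fin n, transferKernel su2Rep β (Us i.castSucc) (Us i.succ)) *
        transferKernel su2Rep β (Us (Fin.last n)) (gaugeTransform g (twist3 z (Us 0))))
      ((Measure.pi fun _ : Fin (n + 1) => configMeasure SU2 L).prod (gaugeMeasure L)) := by
    refine Integrable.of_bound (measurable_seamWeight_uncurry (L := L) β z n).aestronglyMeasurable (M ^ n * M) (ae_of_all _ fun p => ?_)
    rw [uncurry_apply_pair]
    exact abs_seamWeight_le hM0 hM p.1 _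
  rw [sectorWeight_apply]
  simp only [mul_one]
  rw [← integral_integral_swap hint]
  refine integral_congr_ae (ae_of_all _ fun Us => ?_)
  dsimp only
  rw [integral_const_mul, gaugeKernel_apply]

omit [NeZero L] in
/-- The open chain closed by a last bond `G`, as a cyclic product of `m+2` bond kernels. [folklore] -/
theorem seamChain_integrand_eq_prod (K G : GaugeConfig 3 L SU2 → GaugeConfig 3 L SU2 → ℝ) (m : ℕ) (V : Fin (m + 2) → GaugeConfig 3 L SU2) :
    (∏ i : Fin (m + 1), K (V i.castSucc) (V i.succ)) * G (V (Fin.last (m + 1))) (V 0) =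
      ∏ t : Fin (m + 2), (fun s : ℕ => if s = m + 1 then G else K) t (V t) (V (t + 1)) := by
  symm
  rw [Fin.prod_univ_castSucc]
  congr 1
  · refine Finset.prod_congr rfl fun i _ => ?_
    have hi : ((Fin.castSucc i : Fin (m + 2)) : ℕ) ≠ m + 1 := by
      rw [Fin.val_castSucc]; exact ne_of_lt i.isLt
    simp only [hi, if_false, Fin.coeSucc_eq_succ]
  · simp only [Fin.val_last, if_true, Fin.last_add_one]

/-- The twisted right section `(w, x) ↦ K_β^G(w, tw_z x)` is jointly measurable. [folklore] -/
theorem measurable_gaugeKernel_twist_uncurry (β : ℝ) (z : Fin 3 → Bool) :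
    Measurable (uncurry fun w x : GaugeConfig 3 L SU2 => gaugeKernel β w (twist3 z x)) := by
  have hKG := (stronglyMeasurable_gaugeKernel (L := L) β).measurable
  have hmap : Measurable fun p : GaugeConfig 3 L SU2 × GaugeConfig 3 L SU2 => (p.1, twist3 z p.2) :=
    measurable_fst.prodMk ((measurable_twist3 z).comp measurable_snd)
  have h := hKG.comp hmap
  exact h

/-- **Peeling the cycle**: `sectorWeight β (m+1) z 1` is the diagonal integral of the `(m+1)`-st `K_β`-iterate of the twisted section
`K_β^G(·, tw_z x)` (Lit `integral_cyclic_het_eq_foldr`). [cite: MontvayMunster1994, (3.145)] -/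
theorem sectorWeight_one_eq_integral_iterate_K (β : ℝ) (m : ℕ) (z : Fin 3 → Bool) :
    sectorWeight (L := L) β (m + 1) z (fun _ _ => (1 : ℝ)) =
      ∫ x, ((fun f : GaugeConfig 3 L SU2 → ℝ => fun w => ∫ y, transferKernel su2Rep β w y * f y ∂configMeasure SU2 L)^[m + 1]
        (fun w => gaugeKernel β w (twist3 z x))) x ∂configMeasure SU2 L := by
  obtain ⟨M, -, hM⟩ := exists_abs_transferKernel_le (L := L) β
  set κ : ℕ → GaugeConfig 3 L SU2 → GaugeConfig 3 L SU2 → ℝ :=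
    fun s => if s = m + 1 then (fun w x => gaugeKernel β w (twist3 z x)) else transferKernel su2Rep β with hκdef
  have hκ : ∀ t, Measurable (uncurry (κ t)) := fun t => by
    by_cases ht : t = m + 1
    · simp only [hκdef, ht, if_true]; exact measurable_gaugeKernel_twist_uncurry (L := L) β z
    · simp only [hκdef, ht, if_false]; exact (PhysL2.stronglyMeasurable_transferKernel (L := L) β).measurable
  have hC : ∀ t x y, ‖κ t x y‖ ≤ M := fun t x y => by
    rw [Real.norm_eq_abs]
    by_cases ht : t = m + 1
    · simp only [hκdef, ht, if_true]; exact abs_gaugeKernel_le hM x _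
    · simp only [hκdef, ht, if_false]; exact hM x y
  have h1 : sectorWeight (L := L) β (m + 1) z (fun _ _ => (1 : ℝ)) =
      ∫ V : Fin (m + 2) → GaugeConfig 3 L SU2, ∏ t : Fin (m + 2), κ t (V t) (V (t + 1)) ∂(Measure.pi fun _ => configMeasure SU2 L) := by
    rw [sectorWeight_one_eq_integral_gaugeKernel]
    refine integral_congr_ae (ae_of_all _ fun V => ?_)
    exact seamChain_integrand_eq_prod (transferKernel su2Rep β) (fun w x => gaugeKernel β w (twist3 z x)) m V
  have h2 := integral_cyclic_congr_fin (L := L) (show m + 2 = 1 + m + 1 by omega) κ (configMeasure SU2 L)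
  have h3 := integral_cyclic_het_eq_foldr (ρ := configMeasure SU2 L) hκ hC m
  rw [h1, h2, h3]
  refine integral_congr_ae (ae_of_all _ fun x => ?_)
  dsimp only
  have hlast : κ (m + 1) = fun w x => gaugeKernel β w (twist3 z x) := by simp [hκdef]
  have h4 := foldr_op_eq_iterate_of_eq (ρ := configMeasure SU2 L) κ (transferKernel su2Rep β) (m + 1) 0
    (fun i hi => by simp [hκdef, Nat.ne_of_lt hi]) (fun w => κ (m + 1) w x)
  simp only [Nat.add_zero] at h4
  rw [h4, hlast]

/-- **Homogenisation**: on the gauge-invariant section `K_β^G(·, tw_z x)` the `K_β`- and `K_β^G`-iterates agree, so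
`sectorWeight β (m+1) z 1 = ∫ (κ_{K^G}^{[m+1]} K^G(·, tw_z x))(x) dx`. [cite: Luscher1983, §2] -/
theorem sectorWeight_one_eq_integral_iterate (β : ℝ) (m : ℕ) (z : Fin 3 → Bool) :
    sectorWeight (L := L) β (m + 1) z (fun _ _ => (1 : ℝ)) =
      ∫ x, ((fun f : GaugeConfig 3 L SU2 → ℝ => fun w => ∫ y, gaugeKernel β w y * f y ∂configMeasure SU2 L)^[m + 1]
        (fun w => gaugeKernel β w (twist3 z x))) x ∂configMeasure SU2 L := by
  obtain ⟨M, -, hM⟩ := exists_abs_transferKernel_le (L := L) β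
  rw [sectorWeight_one_eq_integral_iterate_K]
  refine integral_congr_ae (ae_of_all _ fun x => ?_)
  dsimp only
  have hseed_m : Measurable fun w : GaugeConfig 3 L SU2 => gaugeKernel β w (twist3 z x) := by
    have h : (fun w : GaugeConfig 3 L SU2 => gaugeKernel β w (twist3 z x)) = fun w => gaugeKernel β (twist3 z x) w :=
      funext fun w => gaugeKernel_symm β w _
    rw [h]; exact measurable_gaugeKernel_right β _
  have hseed_b : ∀ w : GaugeConfig 3 L SU2, |gaugeKernel β w (twist3 z x)| ≤ M := fun w => abs_gaugeKernel_le hM w _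
  have hseed_g : ∀ (g : Site 3 L → SU2) (w : GaugeConfig 3 L SU2), gaugeKernel β (gaugeTransform g w) (twist3 z x) = gaugeKernel β w (twist3 z x) :=
    fun g w => gaugeKernel_gaugeTransform_left β g w _
  exact congrFun ((iterate_gaugeKernelOp_eq (L := L) β hseed_m hseed_b hseed_g (m + 1)).1.symm) x

/-- Joint measurability of the `K_β^G`-iterates of the sections `K_β^G(·, a)` in (parameter, argument). [folklore] -/
theorem measurable_iterate_gaugeKernel_section (β : ℝ) (j : ℕ) :
    Measurable fun p : GaugeConfig 3 L SU2 × GaugeConfig 3 L SU2 =>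
      ((fun f : GaugeConfig 3 L SU2 → ℝ => fun w => ∫ y, gaugeKernel β w y * f y ∂configMeasure SU2 L)^[j]
        (fun w => gaugeKernel β w p.1)) p.2 := by
  have hKG := (stronglyMeasurable_gaugeKernel (L := L) β).measurable
  induction j with
  | zero =>
    simp only [Function.iterate_zero, id_eq]
    have hmap : Measurable fun p : GaugeConfig 3 L SU2 × GaugeConfig 3 L SU2 => (p.2, p.1) := measurable_snd.prodMk measurable_fst
    have h := hKG.comp hmap
    exact h
  | succ j ih =>
    simp only [Function.iterate_succ_apply']
    -- `(p, y) ↦ K^G(p.2, y) · (iterate at (p.1, y))` is jointly measurable; integrate out `y`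
    have hmap1 : Measurable fun q : (GaugeConfig 3 L SU2 × GaugeConfig 3 L SU2) × GaugeConfig 3 L SU2 => (q.1.2, q.2) :=
      (measurable_snd.comp measurable_fst).prodMk measurable_snd
    have hmap2 : Measurable fun q : (GaugeConfig 3 L SU2 × GaugeConfig 3 L SU2) × GaugeConfig 3 L SU2 => (q.1.1, q.2) :=
      (measurable_fst.comp measurable_fst).prodMk measurable_snd
    have hA := hKG.comp hmap1
    have hB := ih.comp hmap2
    have h1 : StronglyMeasurable (uncurry fun (p : GaugeConfig 3 L SU2 × GaugeConfig 3 L SU2) (y : GaugeConfig 3 L SU2) =>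
        gaugeKernel β p.2 y *
          ((fun f : GaugeConfig 3 L SU2 → ℝ => fun w => ∫ y, gaugeKernel β w y * f y ∂configMeasure SU2 L)^[j]
            (fun w => gaugeKernel β w p.1)) y) := (hA.mul hB).stronglyMeasurable
    have h2 := StronglyMeasurable.integral_prod_right (ν := configMeasure SU2 L) h1
    exact h2.measurable

/-- ★ **`sectorWeight β (m+1) z 1` is the TWISTED diagonal iterate** `∫ (κ_{K^G}^{[m+1]} K^G(·, x))(tw_z x) dx` of Lit `TwistedKernelTraceFormula`
(substitute `x ↦ tw_z x`, an involution preserving the a-priori measure). [cite: tHooft1979] [cite: MontvayMunster1994, (3.145)] -/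
theorem sectorWeight_one_eq_integral_iterate_twisted (β : ℝ) (m : ℕ) (z : Fin 3 → Bool) :
    sectorWeight (L := L) β (m + 1) z (fun _ _ => (1 : ℝ)) =
      ∫ x, ((fun f : GaugeConfig 3 L SU2 → ℝ => fun w => ∫ y, gaugeKernel β w y * f y ∂configMeasure SU2 L)^[m + 1]
        (fun w => gaugeKernel β w x)) (twist3 z x) ∂configMeasure SU2 L := by
  rw [sectorWeight_one_eq_integral_iterate]
  have hG := measurable_iterate_gaugeKernel_section (L := L) β (m + 1)
  have hmap : Measurable fun x : GaugeConfig 3 L SU2 => (x, twist3 z x) := measurable_id.prodMk (measurable_twist3 z)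
  have hm0 := hG.comp hmap
  have hm : Measurable fun x : GaugeConfig 3 L SU2 =>
      ((fun f : GaugeConfig 3 L SU2 → ℝ => fun w => ∫ y, gaugeKernel β w y * f y ∂configMeasure SU2 L)^[m + 1]
        (fun w => gaugeKernel β w x)) (twist3 z x) := hm0
  rw [← integral_comp_eq_of_measurePreserving (measurePreserving_twist3 z) hm]
  refine integral_congr_ae (ae_of_all _ fun x => ?_)
  dsimp only
  rw [twist3_twist3_self]

end Summit.QuantumFields.YangMills.Theorems.FemtoTransferGap.TT

end
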